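import Summits.Ventures.PercRepro.S1CircuitProfile

/-!
# PercRepro — THE `k`-SUBSETS OF A BASE ARE INDEPENDENT (p2, gen 28; SUBCLAIM-S1 §6.10; for the connected cores)

`C(r, k) ≤ #{independent k-sets}` for a matroid of rank `r`: the `k`-subsets of any base are independent. The constraint
the profile/kill LP of a connected core is missing (NOTES: «paper note on the CONNECTED cores»). Nothing is claimed
about any cell.

* `choose_le_ncard_indep_of_eRank`.
Axioms: standard.
-/

open scoped Matroid

namespace PercRepro

namespace S1

open Set

variable {α : Type}

/-- The `k`-subsets of a base are independent: `C(r, k) ≤ #{independent k-sets}` for `k ≤ r`. -/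
theorem choose_le_ncard_indep_of_eRank (M : Matroid α) [M.Finite] {r : ℕ} (hM : M.eRank = (r : ℕ∞)) (k : ℕ) :
    Nat.choose r k ≤ {I : Set α | I ⊆ M.E ∧ I.ncard = k ∧ M.Indep I}.ncard := by
  obtain ⟨B, hB⟩ := M.exists_isBase
  have hBE : B ⊆ M.E := hB.subset_ground
  have hBfin : B.Finite := M.ground_finite.subset hBE
  have hBr : B.ncard = r := by
    have := hB.encard_eq_eRank
    rw [hM, ← hBfin.cast_ncard_eq] at this
    exact_mod_cast this
  have hsub : {I : Set α | I ⊆ B ∧ I.ncard = k} ⊆ {I : Set α | I ⊆ M.E ∧ I.ncard = k ∧ M.Indep I} :=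
    fun I ⟨hIB, hIk⟩ => ⟨hIB.trans hBE, hIk, hB.indep.subset hIB⟩
  have h := ncard_le_ncard hsub (M.ground_finite.finite_subsets.subset (fun _ hI => hI.1))
  rwa [ncard_setOf_subset_ncard_eq hBfin k, hBr] at h

end S1

end PercRepro
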